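import Mathlib
import HarnessLib
import Literature.Combinatorics.Additive.Pollard
import Literature.Combinatorics.Additive.Kneser
import Literature.Combinatorics.Additive.GrynkiewiczPollardRep
import Literature.Combinatorics.Additive.GrynkiewiczPollardKneserTools
import Literature.Combinatorics.Additive.GrynkiewiczPollardStepOne
import Literature.Combinatorics.Additive.GrynkiewiczPollardStepTwo
import Literature.Combinatorics.Additive.GrynkiewiczPollardDyson
import Literature.Combinatorics.Additive.GrynkiewiczPollardStepFourA
import Literature.Combinatorics.Additive.GrynkiewiczPollardStepFourB

/-!
# Pollard's theorem in general abelian groups with the constant `−(4/3)t²` (Grynkiewicz–Wang 2026) — I: the Dyson pair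

Topic: `Literature/Combinatorics/Additive`.  First file of the port of

* D. J. Grynkiewicz, R. Wang, *Pollard's theorem in general abelian groups*, arXiv:2601.17922 (2026),
  **Theorem 1.8**: for `t ≥ 2` and finite `A, B` in an abelian group with `|A|, |B| ≥ t`, if
  `Σ_{i=1}^t |A +_i B| < t|A| + t|B| + ⌈−(4/3)t² + (2/3)t⌉` then there are `A′ ⊆ A`, `B′ ⊆ B` with
  `|A ∖ A′| + |B ∖ B′| ≤ t − 1` and `A′ +_t B′ = A′ + B′ = A +_t B` (plus the stabilizer bound) — the
  structural alternative of Grynkiewicz's 2010 theorem [Gry10, Thm 1.1] (tree: `grynkiewicz2010_thm_1_1`,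
  constant `−2t² + 1`) under a hypothesis whose quadratic term is `−(4/3)t²` instead of `−2t²`.

The tree's port of [Gry10] (`GrynkiewiczPollard*.lean`) is parametric in the constant `c` of the dichotomy
`Grynkiewicz.Goal t c A B` («`t(|A|+|B|) ≤ N_t(A,B) + c` or the structural alternative `Str`»); only STEP 3 and
Case 4.1 of that port need `c ≥ 2t² − 1` resp. `c ≥ 2t² − 2t`.  This file redoes the DYSON-PAIR step (the
situation of [Gry10] STEP 4: the maximal translate of `B` meets `A` in at least `t` points) for the constant
`c_t = ⌊(4t² − 2t)/3⌋`, following §2 of the source: after the induction hypothesis is applied to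
`(A ∪ B, A ∩ B)` and STEP 1, **Case 1** (a deleted element of `A ∪ B`; the bound `N_t ≥ t(|A|+|B|) − t² + 1`),
**Case 2** (all deletions in `A ∩ B`; Subcase 2.1 `3ℓ ≤ 2t` uses the theorem for `t − 1` («Claim 1») and the
count `|A +_t B| ≥ |U′ + I′| + |S|`; Subcases 2.2/2.3 `3ℓ > 2t` give `N_t ≥ t(|A|+|B|) − 2t² + 2t + ℓ(t − 2)`), and
**Case 3** (no deletions) = the tree's `Grynkiewicz.case42_of_le` ([Gry10] Case 4.2 under `|H| ≥ ρ + t + 1`; the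
source: «a verbatim copy of Case 2 in the proof of Theorem 1.7 presented in [Gry2]»).  The constants enter only
through the two inequalities `4t² ≤ 3c + 2t + 2` (i.e. `c ≥ ⌈(4t² − 2t − 2)/3⌉ = ⌊(4t²−2t)/3⌋`) and
`3c′ + 10t ≤ 4t² + 6` (i.e. `c′ ≤ (4(t−1)² − 2(t−1))/3`) for the constant `c′` of the level `t − 1`.

## References
* D. J. Grynkiewicz, R. Wang, arXiv:2601.17922 (2026), Theorem 1.8 and §2, Cases 1–3
  [cite: GrynkiewiczWang2026, Thm 1.8].
* D. J. Grynkiewicz, *On extending Pollard's theorem for t-representable sums*, Israel J. Math. 177 (2010)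
  413–439, §2 [cite: Grynkiewicz2010, Thm 1.1].
-/

namespace Literature.Combinatorics.Additive

namespace GrynkiewiczWang

open Finset Pollard Grynkiewicz
open scoped Pointwise

variable {G : Type*} [AddCommGroup G] [DecidableEq G]

/-! ### Counting tools -/

section Tools

variable {t : ℕ} {A B : Finset G}

/-- `N_{t+1}(A,B) = N_t(A,B) + |A +_{t+1} B|` (one more column of the dot diagram).
[cite: GrynkiewiczWang2026, §2 (holes)] -/
theorem NS_succ (t : ℕ) (A B : Finset G) :
    NS (t + 1) A B = NS t A B + ((A + B).filter (fun w => t + 1 ≤ rep A B w)).card := by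
  unfold NS
  rw [card_filter, ← sum_add_distrib]
  refine sum_congr rfl fun w _ => ?_
  by_cases h : t + 1 ≤ rep A B w
  · rw [if_pos h, min_eq_left h, min_eq_left (by omega)]
  · rw [if_neg h, min_eq_right (by omega), min_eq_right (by omega), Nat.add_zero]

/-- `N_{t-1}(A,B) + |A +_t B| = N_t(A,B)` for `t ≥ 1`. [cite: GrynkiewiczWang2026, §2 (holes)] -/
theorem NS_pred_add (ht : 1 ≤ t) (A B : Finset G) :
    NS (t - 1) A B + ((A + B).filter (fun w => t ≤ rep A B w)).card = NS t A B := by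
  obtain ⟨s, rfl⟩ : ∃ s, t = s + 1 := ⟨t - 1, by omega⟩
  rw [Nat.add_sub_cancel, NS_succ]

/-- Two disjoint families of `t`-popular sums give a lower bound for `|A +_t B|`.
[cite: GrynkiewiczWang2026, §2 Subcase 2.1] -/
theorem card_add_card_le_card_popular {P E : Finset G} (hP : P ⊆ A + B) (hPpop : ∀ w ∈ P, t ≤ rep A B w)
    (hE : E ⊆ A + B) (hEpop : ∀ w ∈ E, t ≤ rep A B w) (hd : Disjoint E P) :
    P.card + E.card ≤ ((A + B).filter (fun w => t ≤ rep A B w)).card := by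
  rw [← card_union_of_disjoint hd.symm]
  refine card_le_card fun w hw => ?_
  rw [mem_filter]
  rcases mem_union.1 hw with h | h
  · exact ⟨hP h, hPpop w h⟩
  · exact ⟨hE h, hEpop w h⟩

end Tools

/-! ### The arithmetic of Cases 1 and 2 -/

section Arith

/-- Case 1: with `d = |H| − ρ ≥ t`, `|E| + (t − 1) ≥ d`, `l + 1 ≤ t`, the key count gives
`N_t ≥ t(|A|+|B|) − t² + t − l`, contradicting `N_t + t² < t(|A| + |B|)`.
[cite: GrynkiewiczWang2026, §2 Case 1] -/
theorem case1_arith {t l d e S N P ab : ℕ} (hlt : l + 1 ≤ t) (hd : t ≤ d) (he : d ≤ e + (t - 1))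
    (hS : S + d + l = ab) (hP : l * d ≤ P) (hK : t * S + t * e + P ≤ N + l * e)
    (hW : N + t * t < t * ab) : False := by
  obtain ⟨q, rfl⟩ : ∃ q, t = l + q + 1 := ⟨t - l - 1, by omega⟩
  have ht1 : l + q + 1 - 1 = l + q := by omega
  rw [ht1] at he
  obtain ⟨r, hr⟩ : ∃ r, e + (l + q) = d + r := ⟨e + (l + q) - d, by omega⟩
  have h1 : (q + 1) * (e + (l + q)) = (q + 1) * (d + r) := by rw [hr]
  subst hS
  nlinarith [h1, hP, hK, hW]

/-- Cases 2.2 / 2.3: with `3l ≥ 2t + 1`, `l + 1 ≤ t`, `|E| + (2t − 2) ≥ d = |H| − ρ ≥ t`, the key count gives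
`3 N_t ≥ 3t(|A|+|B|) − 4t² + 3t − 2`, contradicting `N_t + c < t(|A|+|B|)` once `3c ≥ 4t² − 2t − 2`.
[cite: GrynkiewiczWang2026, §2 Subcases 2.2–2.3] -/
theorem case2b_arith {t l d e S N P ab c : ℕ} (hlt : l + 1 ≤ t) (hl : 2 * t + 1 ≤ 3 * l) (hd : t ≤ d)
    (he : d ≤ e + (2 * t - 2)) (hS : S + d + l = ab) (hP : l * d ≤ P) (hK : t * S + t * e + P ≤ N + l * e)
    (hc3 : 4 * t * t ≤ 3 * c + 2 * t + 2) (hPc : N + c < t * ab) : False := by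
  obtain ⟨q, rfl⟩ : ∃ q, t = l + q + 1 := ⟨t - l - 1, by omega⟩
  have ht1 : 2 * (l + q + 1) - 2 = 2 * l + 2 * q := by omega
  rw [ht1] at he
  -- `N ≥ t S + (t - l) e + l d`
  have hN : (l + q + 1) * S + (q + 1) * e + l * d ≤ N := by nlinarith [hK, hP]
  subst hS
  -- `N ≥ t·ab − 2t² + 2t + l(t − 2)`, in the form `N + 2t² + 2l ≥ t·ab + 2t + l t`
  have hN2 : (l + q + 1) * (S + d + l) + 2 * (l + q + 1) + l * (l + q + 1) ≤
      N + 2 * (l + q + 1) * (l + q + 1) + 2 * l := by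
    rcases Nat.lt_or_ge d (2 * l + 2 * q) with hsmall | hbig
    swap
    · obtain ⟨r, rfl⟩ : ∃ r, d = 2 * l + 2 * q + r := ⟨d - (2 * l + 2 * q), by omega⟩
      have her : r ≤ e := by omega
      nlinarith [hN, her]
    · nlinarith [hN, hsmall]
  nlinarith [hN2, hc3, hPc, hl]

/-- Subcase 2.1: with `3l ≤ 2t`, the theorem for `t − 1` («Claim 1»: `(t−1)(|A|+|B|) ≤ N_{t−1} + c′`),
`N_{t−1} + |A +_t B| = N_t`, `|A +_t B| ≥ |U′ + I′| + |E|`, `|E| + (2t − 2) ≥ d`, `|U′ + I′| + d + l = |A| + |B|`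
contradict `N_t + c < t(|A|+|B|)` once `3c ≥ 4t² − 2t − 2` and `3c′ ≤ 4(t−1)² − 2(t−1)`.
[cite: GrynkiewiczWang2026, §2 Subcase 2.1] -/
theorem case2a_arith {t l d e S N N' M ab c c' : ℕ} (ht : 1 ≤ t) (hl : 3 * l ≤ 2 * t)
    (h1 : (t - 1) * ab ≤ N' + c') (hNN : N' + M = N) (hM : S + e ≤ M) (he : d ≤ e + (2 * t - 2))
    (hS : S + d + l = ab) (hc3 : 4 * t * t ≤ 3 * c + 2 * t + 2) (hc' : 3 * c' + 10 * t ≤ 4 * t * t + 6)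
    (hPc : N + c < t * ab) : False := by
  obtain ⟨s, rfl⟩ : ∃ s, t = s + 1 := ⟨t - 1, by omega⟩
  simp only [Nat.add_sub_cancel] at h1
  have e1 : (s + 1) * ab = s * ab + ab := by ring
  rw [e1] at hPc
  have e2 : 4 * (s + 1) * (s + 1) = 4 * (s * s) + 8 * s + 4 := by ring
  rw [e2] at hc3 hc'
  omega

end Arith

/-! ### Cases 1 and 2: the Dyson pair carries a structure with `l ≥ 1` -/

section CaseL

variable {t c c' : ℕ} {A B : Finset G}

/-- **[GrynkiewiczWang2026] §2, Cases 1 and 2.**  In the Dyson-pair situation — `(U,I) = (A ∪ B, A ∩ B)`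
carries a saturated Kneser-tight structure `(U′, I′)` for `t` with `|H| ≥ ρ + t + 1` (STEP 1), the bound
`N_t + c < t(|A| + |B|)` holds, and «Claim 1» `(t−1)(|A|+|B|) ≤ N_{t−1}(A,B) + c′` holds — if `l ≥ 1` then
`Goal t c A B`, provided `3c ≥ 4t² − 2t − 2`, `3c′ ≤ 4(t−1)² − 2(t−1)`, `t² ≤ c`, `t ≥ 3`.
Case 1 (a deleted element of `U`): its row/column is unpopular (STEP 2) or the key count gives
`N_t ≥ t(|A|+|B|) − t² + 1`.  Case 2 (`U′ = U`, a deleted `b ∈ I`): the `|H| − ρ_{U′}` partners `u ∈ U′` of `b`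
with `u + b ∉ U′ + I′` carry at most `2t − 2` unpopular sums (row and column of `b`), whence a set `S` of
`≥ |H| − ρ − (2t − 2)` sums with `> t` representations outside `U′ + I′`; Subcase 2.1 (`3l ≤ 2t`) closes by
Claim 1 and `|A +_t B| ≥ |U′ + I′| + |S|`, Subcases 2.2/2.3 (`3l > 2t`) by the key count.
[cite: GrynkiewiczWang2026, §2 Cases 1–2] -/
theorem case_l_pos (ht : 3 ≤ t) (hc : t * t ≤ c) (hc3 : 4 * t * t ≤ 3 * c + 2 * t + 2)
    (hc' : 3 * c' + 10 * t ≤ 4 * t * t + 6) (ih : IH t c A B)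
    (hA : t + 1 ≤ A.card) (hB : t + 1 ≤ B.card) {U' I' : Finset G}
    (hS : Str t (A ∪ B) (A ∩ B) U' I') (hU'ne : U'.Nonempty) (hI'ne : I'.Nonempty)
    (hsU : Sat (A ∪ B) U' (U' + I').addStab) (hsI : Sat (A ∩ B) I' (U' + I').addStab)
    (htight : (U' + I').card + (U' + I').addStab.card =
      (U' + (U' + I').addStab).card + (I' + (U' + I').addStab).card)
    (hHρ : ((U' + (U' + I').addStab).card - U'.card) + ((I' + (U' + I').addStab).card - I'.card) + (t + 1) ≤
      (U' + I').addStab.card)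
    (hP : NS t A B + c < t * (A.card + B.card))
    (h1 : (t - 1) * (A.card + B.card) ≤ NS (t - 1) A B + c')
    (hl : 1 ≤ ((A ∪ B) \ U').card + ((A ∩ B) \ I').card) : Goal t c A B := by
  have hW : NS t A B + t * t < t * (A.card + B.card) := by omega
  set U := A ∪ B with hU
  set I := A ∩ B with hI
  set H := (U' + I').addStab with hH
  set l := (U \ U').card + (I \ I').card with hl'
  set ρ := ((U' + H).card - U'.card) + ((I' + H).card - I'.card) with hρ
  have hSne : (U' + I').Nonempty := hU'ne.add hI'ne
  have hper : U' + I' + H = U' + I' := add_addStab _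
  have hrep : ∀ w, rep U I w ≤ rep A B w := rep_union_inter_le A B
  have hsubUI : U + I ⊆ A + B := union_add_inter_subset A B
  have hlt : l + 1 ≤ t := hS.2.2.1
  have hρU : U'.card ≤ (U' + H).card := card_le_card_add_addStab hSne U'
  have hρI : I'.card ≤ (I' + H).card := card_le_card_add_addStab hSne I'
  obtain ⟨d, hd⟩ : ∃ d, H.card = ρ + d := ⟨H.card - ρ, by omega⟩
  have hdt : t ≤ d := by omega
  have hpairs := pairs_outside_ge hS.1 hS.2.1 hU'ne hI'ne htight hsU hsI
  rw [← hH, ← hl', hd, Nat.add_sub_cancel_left] at hpairs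
  have hcU := card_sdiff_add_card_eq_card hS.1
  have hcI := card_sdiff_add_card_eq_card hS.2.1
  have hcardUI : U.card + I.card = A.card + B.card := card_union_add_card_inter A B
  have hSd : (U' + I').card + d + l = A.card + B.card := by omega
  -- the structure's sums are `t`-popular in `A + B`
  have hPpop : ∀ w ∈ U' + I', t ≤ rep A B w := fun w hw => (hS.2.2.2.1 w hw).trans
    ((rep_mono hS.1 hS.2.1 w).trans (hrep w))
  have hPsub : U' + I' ⊆ A + B := hS.add_subset.trans hsubUI
  by_cases hUeq : U' = U
  · -- Case 2: `U' = U`, some `b ∈ I \ I'`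
    have hIne : I' ≠ I := by
      intro h; rw [hUeq, h] at hl'; simp at hl'; omega
    obtain ⟨b, hbI, hbI'⟩ := exists_of_ssubset (hS.2.1.ssubset_of_ne hIne)
    have hbA : b ∈ A := (mem_inter.1 hbI).1
    have hbB : b ∈ B := (mem_inter.1 hbI).2
    have hbH : b ∉ I' + H := fun h => hbI' (hsI b hbI h)
    have hF := card_filter_add_not_mem_ge_right hU'ne hI'ne htight hbH
    rw [← hH] at hF
    set F := U'.filter (fun u => u + b ∉ U' + I') with hFdef
    -- unpopular row / column of `b`
    by_cases hrow : t ≤ (A.filter (fun a => rep A B (a + b) ≤ t)).card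
    · exact goal_of_row (by omega) hc ih hA hB hbB hrow
    by_cases hcol : t ≤ (B.filter (fun β => rep A B (b + β) ≤ t)).card
    · exact goal_of_col (by omega) hc ih hA hB hbA hcol
    rw [not_le] at hrow hcol
    exfalso
    have hFout : ∀ u ∈ F, b + u ∉ U' + I' := fun u hu => by
      rw [add_comm b u]; exact (mem_filter.1 hu).2
    -- the popular sums `b + u`, `u ∈ F`, `r > t`: at most `2t − 2` exceptions
    set E := (F.filter (fun u => t < rep A B (b + u))).image (b + ·) with hEdef
    have hE1 : F.card ≤ E.card + (2 * t - 2) := by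
      rw [hEdef, card_image_of_injective _ (add_right_injective b)]
      have := card_filter_add_card_filter_not (s := F) (fun u => rep A B (b + u) ≤ t)
      have e : F.filter (fun u => ¬ rep A B (b + u) ≤ t) = F.filter (fun u => t < rep A B (b + u)) :=
        filter_congr fun u _ => not_le
      rw [e] at this
      have hsplit : F.filter (fun u => rep A B (b + u) ≤ t) ⊆
          A.filter (fun a => rep A B (a + b) ≤ t) ∪ B.filter (fun β => rep A B (b + β) ≤ t) := by
        intro u hu
        rw [mem_filter] at hu
        have huU : u ∈ U := hS.1 (mem_filter.1 hu.1).1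
        rw [mem_union, mem_filter, mem_filter]
        rcases mem_union.1 huU with huA | huB
        · left; exact ⟨huA, by rw [add_comm]; exact hu.2⟩
        · right; exact ⟨huB, hu.2⟩
      have := (card_le_card hsplit).trans (card_union_le _ _)
      omega
    have hE2 : Disjoint E (U' + I') := by
      rw [disjoint_left]
      intro w hw hwP
      obtain ⟨u, hu, rfl⟩ := mem_image.1 hw
      exact hFout u (mem_filter.1 hu).1 hwP
    have hE3 : ∀ w ∈ E, t ≤ rep A B w := by
      intro w hw
      obtain ⟨u, hu, rfl⟩ := mem_image.1 hw
      exact (mem_filter.1 hu).2.le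
    have hEsub : E ⊆ A + B := by
      intro w hw
      obtain ⟨u, hu, rfl⟩ := mem_image.1 hw
      have huU : u ∈ U := hS.1 (mem_filter.1 (mem_filter.1 hu).1).1
      rcases mem_union.1 huU with huA | huB
      · rw [add_comm b u]; exact add_mem_add huA hbB
      · exact add_mem_add hbA huB
    have hK := key_count hS hrep hsubUI hEsub hE2 hE3
    rw [← hl'] at hK
    have he : d ≤ E.card + (2 * t - 2) := by omega
    by_cases hl3 : 2 * t + 1 ≤ 3 * l
    · -- Subcases 2.2 / 2.3
      exact case2b_arith hlt hl3 hdt he hSd hpairs hK hc3 hP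
    · -- Subcase 2.1: Claim 1 and `|A +_t B| ≥ |U' + I'| + |E|`
      rw [not_le] at hl3
      have hM := card_add_card_le_card_popular hPsub hPpop hEsub hE3 hE2
      have hNN := NS_pred_add (t := t) (by omega) A B
      exact case2a_arith (by omega) (by omega) h1 hNN hM he hSd hc3 hc' hP
  · -- Case 1: some `a ∈ U \ U'`
    obtain ⟨a, haU, haU'⟩ := exists_of_ssubset (hS.1.ssubset_of_ne hUeq)
    have haH : a ∉ U' + H := fun h => haU' (hsU a haU h)
    have hF := card_filter_add_not_mem_ge_left hU'ne hI'ne htight haH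
    rw [← hH] at hF
    set F := I'.filter (fun i => a + i ∉ U' + I') with hFdef
    have hFout : ∀ i ∈ F, a + i ∉ U' + I' := fun i hi => (mem_filter.1 hi).2
    have hFI : ∀ i ∈ F, i ∈ I := fun i hi => hS.2.1 (mem_filter.1 hi).1
    rcases mem_union.1 haU with haA | haB
    · -- `a ∈ A`: its column
      by_cases hcol : t ≤ (B.filter (fun β => rep A B (a + β) ≤ t)).card
      · exact goal_of_col (by omega) hc ih hA hB haA hcol
      rw [not_le] at hcol
      exfalso
      have hfew : (F.filter (fun i => rep A B (a + i) ≤ t)).card + 1 ≤ t := by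
        have hsplit : F.filter (fun i => rep A B (a + i) ≤ t) ⊆ B.filter (fun β => rep A B (a + β) ≤ t) := by
          intro i hi
          rw [mem_filter] at hi ⊢
          exact ⟨(mem_inter.1 (hFI i hi.1)).2, hi.2⟩
        have := card_le_card hsplit
        omega
      obtain ⟨hE1, hE2, hE3⟩ := popular_part (A := A) (B := B) (t := t) hFout hfew
      set E := (F.filter (fun i => t < rep A B (a + i))).image (a + ·) with hEdef
      have hEsub : E ⊆ A + B := by
        intro w hw
        obtain ⟨i, hi, rfl⟩ := mem_image.1 hw
        exact add_mem_add haA (mem_inter.1 (hFI i (mem_filter.1 hi).1)).2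
      have hK := key_count hS hrep hsubUI hEsub hE2 hE3
      rw [← hl'] at hK
      exact case1_arith hlt hdt (by omega) hSd hpairs hK hW
    · -- `a ∈ B`: its row
      by_cases hrow : t ≤ (A.filter (fun α => rep A B (α + a) ≤ t)).card
      · exact goal_of_row (by omega) hc ih hA hB haB hrow
      rw [not_le] at hrow
      exfalso
      have hfew : (F.filter (fun i => rep A B (a + i) ≤ t)).card + 1 ≤ t := by
        have hsplit : F.filter (fun i => rep A B (a + i) ≤ t) ⊆ A.filter (fun α => rep A B (α + a) ≤ t) := by
          intro i hi
          rw [mem_filter] at hi ⊢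
          exact ⟨(mem_inter.1 (hFI i hi.1)).1, by rw [add_comm]; exact hi.2⟩
        have := card_le_card hsplit
        omega
      obtain ⟨hE1, hE2, hE3⟩ := popular_part (A := A) (B := B) (t := t) hFout hfew
      set E := (F.filter (fun i => t < rep A B (a + i))).image (a + ·) with hEdef
      have hEsub : E ⊆ A + B := by
        intro w hw
        obtain ⟨i, hi, rfl⟩ := mem_image.1 hw
        rw [add_comm a i]
        exact add_mem_add (mem_inter.1 (hFI i (mem_filter.1 hi).1)).1 haB
      have hK := key_count hS hrep hsubUI hEsub hE2 hE3
      rw [← hl'] at hK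
      exact case1_arith hlt hdt (by omega) hSd hpairs hK hW

end CaseL

/-! ### The Dyson-pair step -/

section DysonPair

variable {t c c' : ℕ} {A B : Finset G}

/-- **The Dyson-pair step of [GrynkiewiczWang2026] §2** (the part of the proof after Claim 5, with the
translate already applied to `B`): if `I = A ∩ B` has `t ≤ |I| < |B|` and every translate of `B` is inside
`A` or meets it in at most `|I|` points, then `Goal t c A B` — apply the induction hypothesis to
`(A ∪ B, A ∩ B)`, STEP 1, then Cases 1–2 (`case_l_pos`) or Case 3 (`Grynkiewicz.case42_of_le`).  Requires
`t ≥ 3`, `t² ≤ c`, `3c ≥ 4t² − 2t − 2`, `3c′ ≤ 4(t−1)² − 2(t−1)` and «Claim 1» at `(A,B)`.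
[cite: GrynkiewiczWang2026, §2 Cases 1–3] -/
theorem dyson_pair (ht : 3 ≤ t) (hc : t * t ≤ c) (hc3 : 4 * t * t ≤ 3 * c + 2 * t + 2)
    (hc' : 3 * c' + 10 * t ≤ 4 * t * t + 6) (ih : IH t c A B)
    (hBA : B.card ≤ A.card) (hB : t + 1 ≤ B.card) (hIt : t ≤ (A ∩ B).card) (hIB : (A ∩ B).card < B.card)
    (hmax : ∀ z : G, (A ∩ (z +ᵥ B)).card ≤ (A ∩ B).card ∨ z +ᵥ B ⊆ A)
    (h1 : (t - 1) * (A.card + B.card) ≤ NS (t - 1) A B + c') : Goal t c A B := by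
  have hA : t + 1 ≤ A.card := hB.trans hBA
  by_cases hP : t * (A.card + B.card) ≤ NS t A B + c
  · exact Or.inl hP
  rw [not_le] at hP
  set U := A ∪ B with hU
  set I := A ∩ B with hI
  have hcardUI : U.card + I.card = A.card + B.card := card_union_add_card_inter A B
  have hNSUI : NS t U I ≤ NS t A B := NS_union_inter_le t A B
  have hIU : I.card ≤ U.card := card_le_card (inter_subset_left.trans subset_union_left)
  have hUt : t ≤ U.card := by omega
  have hmeas : meas t U I < meas t A B := by
    rcases hNSUI.lt_or_eq with h | h
    · exact meas_lt_of_NS_lt h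
    · refine meas_lt_of_min_lt h hcardUI ?_
      rw [min_eq_right hIU, min_eq_right hBA]; exact hIB
  rcases ih U I hmeas hUt hIt with hPUI | ⟨U', I', hS⟩
  · left; rw [← hcardUI]; omega
  obtain ⟨hU'ne, hI'ne⟩ := hS.nonempty hUt hIt
  obtain ⟨U'', I'', hS2, hsum, hsubU, hsubI, hsU, hsI⟩ := hS.saturate hU'ne hI'ne
  rw [← hsum] at hsU hsI
  have hU''ne : U''.Nonempty := hU'ne.mono hsubU
  have hI''ne : I''.Nonempty := hI'ne.mono hsubI
  rcases step_one hS2 hU''ne hI''ne hsU hsI with h0 | ⟨htight, hHρ, -⟩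
  · left; rw [← hcardUI]; omega
  have hcU := card_sdiff_add_card_eq_card hS2.1
  have hcI := card_sdiff_add_card_eq_card hS2.2.1
  have hHρ' : ((U'' + (U'' + I'').addStab).card - U''.card) + ((I'' + (U'' + I'').addStab).card - I''.card) +
      (t + 1) ≤ (U'' + I'').addStab.card := by omega
  by_cases hl0 : (U \ U'').card + (I \ I'').card = 0
  · -- Case 3: no deletions, `U'' = U`, `I'' = I`
    have hUeq : U'' = U := eq_of_subset_of_card_le hS2.1 (by omega)
    have hIeq : I'' = I := eq_of_subset_of_card_le hS2.2.1 (by omega)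
    have hpop := hS2.2.2.2.1
    subst hUeq; subst hIeq
    exact case42_of_le (by omega) hc ih hBA hB hIt hIB hmax hpop htight hHρ' hP
  · have hl1 : 1 ≤ ((A ∪ B) \ U'').card + ((A ∩ B) \ I'').card := by rw [← hU, ← hI]; omega
    exact case_l_pos ht hc hc3 hc' ih hA hB hS2 hU''ne hI''ne hsU hsI htight hHρ' hP h1 hl1

end DysonPair

end GrynkiewiczWang

end Literature.Combinatorics.Additive
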